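import Mathlib
import HarnessLib
import Summits.ValiantsHypothesis.ValiantsHypothesis.Theorems.LacunarySymmetroidMatrixDescartesProductPlusOneSixthOrderShell

/-!
# LINE (A) `product_plus_one` (crux `MatrixDescartes`, stmt-ValiantsHypothesis-18050, V1) — W-CB, brick E4♯b: the abstract θ-SHELL OF ORDER EIGHT with REAL
# exponents («nine zeros of `S₀` in a window ⇒ a zero of `∏ᵢ(θ² − cᵢ²) S₀`», `cᵢ` arbitrary reals)

The order-8 certificate `Λ₄♯ = (θ² − a²)(θ² − b²)(θ² − (a+b)²)(θ² − (3a²+b²))` of pen val-idea-25 g5 memo §28.2′ has a fourth root OFF the square lattice, so the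
Rolle carriers are REAL powers `t^c` (`Real.rpow`), not `t^{k+1}`: this file redoes ✓ `…SixthOrderShell`'s steps with a real exponent and chains four factors.

* `theta_rolle_rpow (c : ℝ)` — two zeros `a < b` of `R` inside `(u,v)` (`0 ≤ u`), `θR = R₁` ⇒ some `y ∈ (a,b)` with `c·R(y) + R₁(y) = 0` (Rolle on `t^c·R(t)`,
  ANY real `c`; `c ↦ −c` is the down-step);
* `theta_sq_chain_real (c : ℝ)` — `m + 3` zeros of `R` ⇒ `m + 1` zeros of `R₂ − c²·R` (steps `c`, then `−c`; ✓ `chain_step`);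
* ★ `no_nine_zeros_of_eighth_order_law (c₁ c₂ c₃ c₄ : ℝ)` — tower `S₀…S₈` with `θSᵢ = Sᵢ₊₁` on the window; if
  `L₄S := S₈ − e₁S₆ + e₂S₄ − e₃S₂ + e₄S₀ ≠ 0` on the window (`eₖ` = elementary symmetric functions of `tᵢ := cᵢ²`), then `S₀` has no strictly increasing chain of
  NINE zeros there (Fin 9 → 7 → 5 → 3 → 1).
USE (E4♯c): binomial companies on `a < b ≤ 2a` with `c = (a, b, a+b, √(3a²+b²))`; row values ✓/⧗ `…EighthOrderRowLaws`.

HONEST FRAMING: abstract calculus; proves nothing about `WronskianBudgetK3` / `OneChangeFloorK3` / the stubs / 18050 / `MatrixDescartes` / B by itself; `VP ≠ VNP` is NOT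
proved.  No definitions, no named facts, no sorry; Mathlib + ✓ `…SixthOrderShell` (for `chain_step`) only.
-/

set_option linter.dupNamespace false

namespace Summit.ValiantsHypothesis.ValiantsHypothesis.Theorems.LacunarySymmetroidMatrixDescartes

namespace ProductPlusOne

open Set

/-! ### §1 One Rolle step with a real exponent -/

/-- **Rolle step, real exponent**: `R(a) = R(b) = 0`, `a < b` inside `(u,v)` (`0 ≤ u`), `θR = R₁` ⇒ some `y ∈ (a,b)` has `c·R(y) + R₁(y) = 0`
(Rolle for `t ↦ t^c·R(t)`, `c` any real). [this file's lemma] -/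
theorem theta_rolle_rpow (c : ℝ) {R R₁ : ℝ → ℝ} {u v : ℝ} (hu : 0 ≤ u)
    (hR : ∀ x ∈ Ioo u v, HasDerivAt R (R₁ x / x) x) {a b : ℝ} (ha : a ∈ Ioo u v) (hb : b ∈ Ioo u v) (hab : a < b)
    (hza : R a = 0) (hzb : R b = 0) : ∃ y ∈ Ioo a b, c * R y + R₁ y = 0 := by
  have hpos : ∀ x ∈ Ioo u v, 0 < x := fun x hx => hu.trans_lt hx.1
  have hF : ∀ x ∈ Ioo u v, HasDerivAt (fun t : ℝ => t ^ c * R t) (x ^ (c - 1) * (c * R x + R₁ x)) x := by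
    intro x hx
    have hx0 : x ≠ 0 := (hpos x hx).ne'
    have hp : HasDerivAt (fun t : ℝ => t ^ c) (c * x ^ (c - 1)) x := Real.hasDerivAt_rpow_const (Or.inl hx0)
    refine (hp.mul (hR x hx)).congr_deriv ?_
    rw [Real.rpow_sub_one hx0]
    field_simp
  have hsub : Icc a b ⊆ Ioo u v := fun t ht => ⟨ha.1.trans_le ht.1, ht.2.trans_lt hb.2⟩
  have hcont : ContinuousOn (fun t : ℝ => t ^ c * R t) (Icc a b) :=
    fun x hx => (hF x (hsub hx)).continuousAt.continuousWithinAt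
  obtain ⟨y, hy, hy'⟩ := exists_hasDerivAt_eq_zero hab hcont (by simp [hza, hzb])
    (fun t ht => hF t (hsub (Ioo_subset_Icc_self ht)))
  refine ⟨y, hy, ?_⟩
  have hyI : y ∈ Ioo u v := hsub (Ioo_subset_Icc_self hy)
  have hyc : 0 < y ^ (c - 1) := Real.rpow_pos_of_pos (hpos y hyI) _
  exact (mul_eq_zero.1 hy').resolve_left hyc.ne'

/-! ### §2 One factor `θ² − c²`, chained -/

/-- **One factor `θ² − c²` with a real `c`**: with `θR = R₁`, `θR₁ = R₂` on the window, a strictly increasing chain of `m + 3` zeros of `R` yields a strictly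
increasing chain of `m + 1` zeros of `x ↦ R₂ x − c²·R x`, nested strictly inside. [this file's lemma] -/
theorem theta_sq_chain_real (c : ℝ) {R R₁ R₂ : ℝ → ℝ} {u v : ℝ} (hu : 0 ≤ u)
    (hR : ∀ x ∈ Ioo u v, HasDerivAt R (R₁ x / x) x) (hR₁ : ∀ x ∈ Ioo u v, HasDerivAt R₁ (R₂ x / x) x)
    {m : ℕ} (x : Fin (m + 3) → ℝ) (hx : StrictMono x) (hxI : ∀ i, x i ∈ Ioo u v) (hz : ∀ i, R (x i) = 0) :
    ∃ z : Fin (m + 1) → ℝ, StrictMono z ∧ (∀ i, z i ∈ Ioo u v) ∧ (∀ i, R₂ (z i) - c ^ 2 * R (z i) = 0) ∧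
      x 0 < z 0 ∧ z (Fin.last m) < x (Fin.last (m + 2)) := by
  obtain ⟨y, hy, hyI, hNy, hy0, hyl⟩ := chain_step (R := R) (T := fun t => c * R t + R₁ t)
    (fun a b ha hb hab hza hzb => theta_rolle_rpow c hu hR ha hb hab hza hzb) x hx hxI hz
  have hN : ∀ t ∈ Ioo u v, HasDerivAt (fun t => c * R t + R₁ t) (((c * R₁ t + R₂ t)) / t) t := by
    intro t ht
    have h := ((hR t ht).const_mul c).add (hR₁ t ht)
    refine h.congr_deriv ?_
    have ht0 : t ≠ 0 := (hu.trans_lt ht.1).ne'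
    field_simp
  obtain ⟨z, hz', hzI, hTz, hz0, hzl⟩ := chain_step (R := fun t => c * R t + R₁ t)
    (T := fun t => (-c) * (c * R t + R₁ t) + (c * R₁ t + R₂ t))
    (fun a b ha hb hab hza hzb => theta_rolle_rpow (-c) hu hN ha hb hab hza hzb) y hy hyI hNy
  refine ⟨z, hz', hzI, fun i => ?_, hy0.trans hz0, hzl.trans hyl⟩
  have h := hTz i
  linear_combination h

/-! ### §3 The order-8 law -/

/-- ★ **THE θ-SHELL OF ORDER EIGHT (real exponents).**  Tower `S₀ … S₈` with `θSᵢ = Sᵢ₊₁` on the window `(u,v)`, `0 ≤ u`; reals `c₁ … c₄`, `tᵢ := cᵢ²`; if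
`L₄S := S₈ − e₁S₆ + e₂S₄ − e₃S₂ + e₄S₀` (`eₖ` the elementary symmetric functions of the `tᵢ`) is NOWHERE ZERO on the window, then `S₀` has no strictly increasing
chain of NINE zeros there. [this file's theorem] -/
theorem no_nine_zeros_of_eighth_order_law (c₁ c₂ c₃ c₄ : ℝ) {S₀ S₁ S₂ S₃ S₄ S₅ S₆ S₇ S₈ : ℝ → ℝ} {u v : ℝ} (hu : 0 ≤ u)
    (h0 : ∀ x ∈ Ioo u v, HasDerivAt S₀ (S₁ x / x) x) (h1 : ∀ x ∈ Ioo u v, HasDerivAt S₁ (S₂ x / x) x)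
    (h2 : ∀ x ∈ Ioo u v, HasDerivAt S₂ (S₃ x / x) x) (h3 : ∀ x ∈ Ioo u v, HasDerivAt S₃ (S₄ x / x) x)
    (h4 : ∀ x ∈ Ioo u v, HasDerivAt S₄ (S₅ x / x) x) (h5 : ∀ x ∈ Ioo u v, HasDerivAt S₅ (S₆ x / x) x)
    (h6 : ∀ x ∈ Ioo u v, HasDerivAt S₆ (S₇ x / x) x) (h7 : ∀ x ∈ Ioo u v, HasDerivAt S₇ (S₈ x / x) x)
    (hlaw : ∀ x ∈ Ioo u v,
      S₈ x - (c₁ ^ 2 + c₂ ^ 2 + c₃ ^ 2 + c₄ ^ 2) * S₆ x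
        + (c₁ ^ 2 * c₂ ^ 2 + c₁ ^ 2 * c₃ ^ 2 + c₁ ^ 2 * c₄ ^ 2 + c₂ ^ 2 * c₃ ^ 2 + c₂ ^ 2 * c₄ ^ 2 + c₃ ^ 2 * c₄ ^ 2) * S₄ x
        - (c₁ ^ 2 * c₂ ^ 2 * c₃ ^ 2 + c₁ ^ 2 * c₂ ^ 2 * c₄ ^ 2 + c₁ ^ 2 * c₃ ^ 2 * c₄ ^ 2 + c₂ ^ 2 * c₃ ^ 2 * c₄ ^ 2) * S₂ x
        + c₁ ^ 2 * c₂ ^ 2 * c₃ ^ 2 * c₄ ^ 2 * S₀ x ≠ 0)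
    (x : Fin 9 → ℝ) (hx : StrictMono x) (hxI : ∀ i, x i ∈ Ioo u v) (hz : ∀ i, S₀ (x i) = 0) : False := by
  set p : ℝ := c₁ ^ 2 with hp
  set q : ℝ := c₂ ^ 2 with hq
  set r : ℝ := c₃ ^ 2 with hr
  set s : ℝ := c₄ ^ 2 with hs
  have lin : ∀ {F F₁ G G₁ : ℝ → ℝ} (μ : ℝ), (∀ x ∈ Ioo u v, HasDerivAt F (F₁ x / x) x) → (∀ x ∈ Ioo u v, HasDerivAt G (G₁ x / x) x) →
      ∀ x ∈ Ioo u v, HasDerivAt (fun t => F t - μ * G t) ((F₁ x - μ * G₁ x) / x) x := by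
    intro F F₁ G G₁ μ hF hG x hx
    have h := (hF x hx).sub ((hG x hx).const_mul μ)
    refine h.congr_deriv ?_
    field_simp
  -- level 1: factor c₁
  obtain ⟨y, hy, hyI, hTy, -, -⟩ := theta_sq_chain_real c₁ hu h0 h1 (m := 6) x hx hxI hz
  have hT0 := lin p h2 h0
  have hT1 := lin p h3 h1
  have hT2 := lin p h4 h2
  have hT3 := lin p h5 h3
  obtain ⟨z, hz', hzI, hUz, -, -⟩ := theta_sq_chain_real c₂ hu hT0 hT1 (m := 4) y hy hyI (fun i => by simpa [hp] using hTy i)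
  -- level 2 tower: U = (S₂ − pS₀) tower minus q·
  have hU0 := lin q hT2 hT0
  have hU1 := lin q hT3 hT1
  have hU2 := lin q (lin p h6 h4) hT2
  have hU3 := lin q (lin p h7 h5) hT3
  obtain ⟨w, hw', hwI, hVw, -, -⟩ := theta_sq_chain_real c₃ hu hU0 hU1 (m := 2) z hz' hzI (fun i => by simpa [hq] using hUz i)
  have hV0 := lin r hU2 hU0
  have hV1 := lin r hU3 hU1
  obtain ⟨ω, -, hωI, hWω, -, -⟩ := theta_sq_chain_real c₄ hu hV0 hV1 (m := 0) w hw' hwI (fun i => by simpa [hr] using hVw i)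
  have hfin := hWω 0
  have hl := hlaw (ω 0) (hωI 0)
  rw [← hs] at hfin
  have key : (((S₈ (ω 0) - p * S₆ (ω 0)) - q * (S₆ (ω 0) - p * S₄ (ω 0))) - r * ((S₆ (ω 0) - p * S₄ (ω 0)) - q * (S₄ (ω 0) - p * S₂ (ω 0))))
      - s * (((S₆ (ω 0) - p * S₄ (ω 0)) - q * (S₄ (ω 0) - p * S₂ (ω 0))) - r * ((S₄ (ω 0) - p * S₂ (ω 0)) - q * (S₂ (ω 0) - p * S₀ (ω 0))))
      = S₈ (ω 0) - (p + q + r + s) * S₆ (ω 0) + (p * q + p * r + p * s + q * r + q * s + r * s) * S₄ (ω 0)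
        - (p * q * r + p * q * s + p * r * s + q * r * s) * S₂ (ω 0) + p * q * r * s * S₀ (ω 0) := by ring
  rw [hp, hq, hr, hs] at key hfin
  exact hl (by linarith [hfin, key])

end ProductPlusOne

end Summit.ValiantsHypothesis.ValiantsHypothesis.Theorems.LacunarySymmetroidMatrixDescartes
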